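import Mathlib
import HarnessLib
import Summits.NavierStokesRegularity.NavierStokesRegularity.Theorems.PoloidalWindowDoorPoloidalWindowRigiditySymmetryGerms
import Summits.NavierStokesRegularity.NavierStokesRegularity.Theorems.PoloidalWindowDoorPoloidalWindowRigidityVerticalShearGerm

/-!
# K2 `PoloidalWindowRigidity` (stmt-NavierStokesRegularity-19708) — THE DEGENERATE-SLICE TRICHOTOMY (stub L3 of the lead's
# proposed line «lrc-jet», top form): a poloidal slice that is POINTWISE degenerate — at every point `ω = 0`, or
# `∇_h(v·e₃) = 0` (Clebsch slope `Λ = 0`), or `∂₃v_h = 0` (`Λ = 1`) — forces `v ≡ 0`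

Cell ns-regularity-ideate, seat nsreg-p7 gen 7 (third worker under the K2 lead ns-poloidal-K2-p1).  The lead's LINE-PROPOSAL
«lrc-jet» (HOME/ns-poloidal-K2-p1/LINE-PROPOSAL-lrc-jet.md, 2026-08-27) composes K2 from LRC′ (L1: on the open set
`{ω ≠ 0, Λ ∉ {0,1}}` the vorticity has a horizontal Killing symmetry — research-sized), the analytic continuation of such a
symmetry (L2, ns-poloidal-K2-p3 `…LocalVorticitySymmetry`), and the Λ-DEGENERATE BOOKKEEPING (L3): what happens when that
open set is EMPTY on a slice.  This file is L3 in the form the assembly needs, with no slope function in the statement: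

* `forall_or_exists_open_of_pointwise_or` — topology: on a nonempty open set `V` where pointwise `P y ∨ Q y` with `P` a CLOSED
  condition, either `P` holds on all of `V` or `Q` holds on a nonempty open subset.
* `eq_zero_of_pointwise_degenerate_slice` — CLASS: let `v` be a profile of the route's Type-I class and `s < 0` a slice
  poloidal along `e₃` such that at EVERY point `y` one of (i) `curl v(s)(y) = 0`, (ii) `∂₀v₂ = ∂₁v₂ = 0` at `y`
  (`Λ = 0`), (iii) `∂₂v₀ = ∂₂v₁ = 0` at `y` (`Λ = 1`) holds.  Then `v ≡ 0`.  Proof: if `curl v(s) ≡ 0`, the irrotational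
  germ theorem; otherwise `V = {ω ≠ 0}` is a nonempty open set on which (ii) ∨ (iii) pointwise, (ii) is closed, so
  (ii) holds on an open set or (iii) does — and the flat germ (`…SymmetryGerms.eq_zero_of_horizontalGradient_eq_zero_on_open`)
  or the vertically rigid germ (`…VerticalShearGerm.eq_zero_of_verticalShear_eq_zero_on_open`) concludes.
* `nonflatLiouville_of_pointwise_degenerate_slice` — the same with the crux's conclusion `¬ IsBackwardSingularPoint v 0`.

So the assembly «LRC′ ⇒ S2⁗» splits a slice into `G = {ω ≠ 0, Λ ∉ {0,1}}` (open): `G ≠ ∅` is L1+L2's case, `G = ∅` is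
exactly the hypothesis of this file.

WHAT THIS IS NOT: not a claim about Navier–Stokes regularity, not LRC′, not the crux — the degenerate half of a proposed
line's assembly (bears_on LADDER-NS N0, route PoloidalWindowDoor, crux K2; `--supports` the K2 item).
-/

noncomputable section

-- the summit and its single sub-problem share the name (CONVENTIONS §1), as in every Theorems file
set_option linter.dupNamespace false

namespace Summit.NavierStokesRegularity.NavierStokesRegularity.Theorems.PoloidalWindowDoorPoloidalWindowRigidityDegenerateSlice

open MeasureTheory Set Function Filter Topology Metric InnerProductSpace
open scoped RealInnerProductSpace
open Literature.Analysis Literature.Analysis.FluidPDE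
open Summit.NavierStokesRegularity.NavierStokesRegularity.Theorems.LocalSineTubeDoorProfileAlignedWindowRigidityAncient
open Summit.NavierStokesRegularity.NavierStokesRegularity.Theorems.PoloidalWindowDoorPoloidalWindowRigidityFlat
open Summit.NavierStokesRegularity.NavierStokesRegularity.Theorems.PoloidalWindowDoorPoloidalWindowRigiditySymmetryGerms
open Summit.NavierStokesRegularity.NavierStokesRegularity.Theorems.PoloidalWindowDoorPoloidalWindowRigidityVerticalShearGerm

variable {C : ℝ} {v : ℝ → EuclideanSpace ℝ (Fin 3) → EuclideanSpace ℝ (Fin 3)}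

/-! ### topology: a pointwise disjunction with a closed first alternative -/

/-- On a nonempty open set `V` where pointwise `P y ∨ Q y`, with `{y | P y}` closed: either `P` holds at every point of
`V`, or `Q` holds on some nonempty open subset of `V`. -/
theorem forall_or_exists_open_of_pointwise_or {X : Type*} [TopologicalSpace X] {V : Set X} (hV : IsOpen V)
    {P Q : X → Prop} (hP : IsClosed {y | P y}) (h : ∀ y ∈ V, P y ∨ Q y) :
    (∀ y ∈ V, P y) ∨ ∃ W : Set X, IsOpen W ∧ W.Nonempty ∧ W ⊆ V ∧ ∀ y ∈ W, Q y := by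
  by_cases hall : ∀ y ∈ V, P y
  · exact Or.inl hall
  · push Not at hall
    obtain ⟨y₁, hy₁V, hy₁⟩ := hall
    refine Or.inr ⟨V ∩ {y | P y}ᶜ, hV.inter hP.isOpen_compl, ⟨y₁, hy₁V, hy₁⟩, inter_subset_left, fun y hy => ?_⟩
    exact (h y hy.1).resolve_left hy.2

/-! ### the class: pointwise degenerate poloidal slices are trivial -/

/-- **THE DEGENERATE-SLICE TRICHOTOMY.**  Let `v` be a profile of the route's Type-I class and `s < 0` a slice poloidal
along `e₃` such that at every point `y` one of the following holds: (i) `curl v(s)(y) = 0`; (ii) `∂₀v₂(y) = ∂₁v₂(y) = 0`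
(the Clebsch slope vanishes); (iii) `∂₂v₀(y) = ∂₂v₁(y) = 0` (the Clebsch slope is `1`).  Then `v ≡ 0` on the slab. -/
theorem eq_zero_of_pointwise_degenerate_slice (hrate : HasTypeITimeDecay C v)
    (hcont : ContinuousOn (uncurry v) (Iio (0 : ℝ) ×ˢ univ))
    (hmild : ∀ s t : ℝ, s < t → t < 0 → ∀ x,
      v t x = UnboundedOperators.heatExtension (v s) (t - s) x - oseenDuhamel 1 s v v t x)
    (hdiv : ∀ t < 0, VectorCalculus.IsDivFree (v t)) {s : ℝ} (hs : s < 0)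
    (hpol : ∀ y, ⟪curl (v s) y, EuclideanSpace.single 2 1⟫_ℝ = 0)
    (h : ∀ y, curl (v s) y = 0 ∨
      (fderiv ℝ (v s) y (EuclideanSpace.single 0 1) 2 = 0 ∧ fderiv ℝ (v s) y (EuclideanSpace.single 1 1) 2 = 0) ∨
      (fderiv ℝ (v s) y (EuclideanSpace.single 2 1) 0 = 0 ∧ fderiv ℝ (v s) y (EuclideanSpace.single 2 1) 1 = 0)) :
    ∀ t < 0, ∀ x, v t x = 0 := by
  have hbdd := bdd_of_hasTypeITimeDecay hrate
  have hA : AnalyticOnNhd ℝ (v s) univ := analyticOnNhd_slice hcont hbdd hmild hs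
  have hC2 : ContDiff ℝ 2 (v s) := hA.contDiff
  have hC1 : ContDiff ℝ 1 (v s) := hA.contDiff
  -- continuity of the curl and of the partial derivatives
  have hcurlc : Continuous (curl (v s)) := (contDiff_curl (n := 1) hC2).continuous
  have hDc : ∀ (e : EuclideanSpace ℝ (Fin 3)) (i : Fin 3), Continuous fun y => fderiv ℝ (v s) y e i := fun e i =>
    (EuclideanSpace.proj (𝕜 := ℝ) i).continuous.comp ((hC1.continuous_fderiv one_ne_zero).clm_apply continuous_const)
  -- the open set `V = {ω ≠ 0}`
  set V : Set (EuclideanSpace ℝ (Fin 3)) := {y | curl (v s) y ≠ 0} with hVdef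
  have hV : IsOpen V := isOpen_ne_fun hcurlc continuous_const
  by_cases hVe : V = ∅
  · -- `curl v(s) ≡ 0`: the irrotational germ on the whole slice
    have h0 : ∀ y ∈ (univ : Set (EuclideanSpace ℝ (Fin 3))), curl (v s) y = 0 := by
      intro y _
      by_contra hy
      have : y ∈ V := hy
      rw [hVe] at this
      exact this
    exact eq_zero_of_curl_eq_zero_on_open hrate hcont hmild hdiv hs isOpen_univ univ_nonempty h0
  -- otherwise `V` is a nonempty open set on which (ii) ∨ (iii) pointwise, and (ii) is a closed condition
  have hVne : V.Nonempty := nonempty_iff_ne_empty.2 hVe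
  have hii_closed : IsClosed {y : EuclideanSpace ℝ (Fin 3) |
      fderiv ℝ (v s) y (EuclideanSpace.single 0 1) 2 = 0 ∧ fderiv ℝ (v s) y (EuclideanSpace.single 1 1) 2 = 0} :=
    (isClosed_eq (hDc _ 2) continuous_const).inter (isClosed_eq (hDc _ 2) continuous_const)
  have hVor : ∀ y ∈ V,
      (fderiv ℝ (v s) y (EuclideanSpace.single 0 1) 2 = 0 ∧ fderiv ℝ (v s) y (EuclideanSpace.single 1 1) 2 = 0) ∨
      (fderiv ℝ (v s) y (EuclideanSpace.single 2 1) 0 = 0 ∧ fderiv ℝ (v s) y (EuclideanSpace.single 2 1) 1 = 0) :=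
    fun y hy => (h y).resolve_left hy
  rcases forall_or_exists_open_of_pointwise_or hV hii_closed hVor with hii | ⟨W, hW, hWne, -, hiii⟩
  · -- (ii) on the nonempty open set `V`: the flat germ
    exact eq_zero_of_horizontalGradient_eq_zero_on_open hrate hcont hmild hdiv hs hpol hV hVne fun y hy => (hii y hy).1
  · -- (iii) on a nonempty open `W`: the vertically rigid germ
    exact eq_zero_of_verticalShear_eq_zero_on_open hrate hcont hmild hdiv hs hW hWne hiii

/-- **The degenerate-slice trichotomy, crux form**: not backward-singular at the apex. -/
theorem nonflatLiouville_of_pointwise_degenerate_slice (hrate : HasTypeITimeDecay C v)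
    (hcont : ContinuousOn (uncurry v) (Iio (0 : ℝ) ×ˢ univ))
    (hmild : ∀ s t : ℝ, s < t → t < 0 → ∀ x,
      v t x = UnboundedOperators.heatExtension (v s) (t - s) x - oseenDuhamel 1 s v v t x)
    (hdiv : ∀ t < 0, VectorCalculus.IsDivFree (v t)) {s : ℝ} (hs : s < 0)
    (hpol : ∀ y, ⟪curl (v s) y, EuclideanSpace.single 2 1⟫_ℝ = 0)
    (h : ∀ y, curl (v s) y = 0 ∨
      (fderiv ℝ (v s) y (EuclideanSpace.single 0 1) 2 = 0 ∧ fderiv ℝ (v s) y (EuclideanSpace.single 1 1) 2 = 0) ∨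
      (fderiv ℝ (v s) y (EuclideanSpace.single 2 1) 0 = 0 ∧ fderiv ℝ (v s) y (EuclideanSpace.single 2 1) 1 = 0)) :
    ¬ IsBackwardSingularPoint v 0 :=
  not_backwardSingular_of_zero (eq_zero_of_pointwise_degenerate_slice hrate hcont hmild hdiv hs hpol h)

end Summit.NavierStokesRegularity.NavierStokesRegularity.Theorems.PoloidalWindowDoorPoloidalWindowRigidityDegenerateSlice

end
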